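import Summits.PneNP.PneNP.Theorems.SingleThreshold.Negative.LoadBearing

/-!
# A CLT-invisible sprinkle: `TV(G(n, p_c ⊕ n^{-σ}), G(n, p_c)) → 0` for `σ > 1 + 1/(k-1)`

Route `OneSlice`, crux `Summit.PneNP.PneNP.Theses.OneSlice.SingleThreshold` (stmt-PneNP-2833), line
`two-round-exposure`: the registered stub `stub_gnpTVSprinkle` (stub G), consumed as a hypothesis by
the dose transfer `stub_doseTransfer` (`OneSliceSingleThresholdDoseTransfer.lean`).

**What.** For `k ≥ 3` and `σ > 1 + 1/(k-1)`, with `p = p_c = n^{-2/(k-1)}` (`pc n k`), the dose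
density `ρ = n^{-σ}` and `p ⊕ ρ = p + ρ − pρ` (the law of `G(n,p) ∪ G(n,ρ)`), the total variation
distance between the two product Bernoulli measures on the edge vectors of `K_n` vanishes:
`Σ_z |w_{p ⊕ ρ}(z) − w_p(z)| → 0`.

**How (χ² of product measures).** For `0 < p < 1` and any `p'`:
* Cauchy–Schwarz against the probability vector `w_p`:
  `(Σ_z |w_{p'}(z) − w_p(z)|)² ≤ Σ_z (w_{p'}(z) − w_p(z))²/w_p(z) = Σ_z w_{p'}(z)²/w_p(z) − 1`
  (`tv_sq_le_chiSq`);
* coordinatewise, `w_{p'}(z)²/w_p(z) = Π_e g(z_e)` with `g(1) = p'²/p`, `g(0) = (1−p')²/(1−p)`, so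
  `Σ_z w_{p'}²/w_p = (p'²/p + (1−p')²/(1−p))^{C(n,2)}` (`sum_gnpWeight_sq_div`, product–sum exchange
  `sum_boolVec_prod`);
* for `p' = p ⊕ ρ`, `p' − p = ρ(1−p)` and the base is `1 + ρ²(1−p)/p` (`chiSq_base_sprinkle`);
* `(1 + a)^N − 1 ≤ exp(Na) − 1 ≤ 2Na` once `0 ≤ Na ≤ 1` (`one_add_pow_sub_one_le_two_mul`), and
  `N ρ²(1−p)/p ≤ (n²/2)·n^{−2σ}·n^{2/(k−1)} = n^{−γ}/2` with `γ = 2σ − 2 − 2/(k−1) > 0`;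
so eventually `TV² ≤ n^{−γ}`, `TV ≤ √(n^{−γ}) → 0`.

## References

* S. Janson, T. Łuczak, A. Ruciński, *Random Graphs*, Wiley (2000), §1.6 (asymptotic equivalence of
  `G(n,p)` and `G(n,p')` when `|p − p'| C(n,2) ≪ √(C(n,2) p)`), folklore.
-/

noncomputable section

set_option linter.dupNamespace false

open Finset Filter

open scoped Classical Topology

namespace Summit.PneNP.PneNP.Theorems.SingleThreshold

open Literature.Computability.Complexity
open Summit.PneNP.PneNP.Theorems.SingleThreshold.Negative (Edges pc pc_nonneg pc_le_one tendsto_pc)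

/-! ### The χ² of two product Bernoulli measures on the edge vectors -/

/-- **Product formula for the χ²-sum.** For any reals `p, p'`:
`Σ_z w_{p'}(z)²/w_p(z) = (p'²/p + (1−p')²/(1−p))^{C(n,2)}` — coordinatewise
`w_{p'}(z)²/w_p(z) = Π_e g(z_e)` with `g(1) = p'²/p`, `g(0) = (1−p')²/(1−p)` (`gnpWeight_eq_prod`), then
the product–sum exchange `sum_boolVec_prod` over the `C(n,2)` edges. [folklore] -/
theorem sum_gnpWeight_sq_div {n : ℕ} (p p' : ℝ) :
    ∑ z : Edges n → Bool, gnpWeight n p' z ^ 2 / gnpWeight n p z =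
      (p' ^ 2 / p + (1 - p') ^ 2 / (1 - p)) ^ (n.choose 2) := by
  have key : ∀ z : Edges n → Bool, gnpWeight n p' z ^ 2 / gnpWeight n p z =
      ∏ e, (if z e = true then p' ^ 2 / p else (1 - p') ^ 2 / (1 - p)) := by
    intro z
    rw [gnpWeight_eq_prod, gnpWeight_eq_prod, ← prod_pow, ← prod_div_distrib]
    refine prod_congr rfl fun e _ => ?_
    split_ifs <;> rfl
  rw [sum_congr rfl fun z _ => key z,
    sum_boolVec_prod (fun _ b => if b = true then p' ^ 2 / p else (1 - p') ^ 2 / (1 - p))]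
  simp only [ite_true, Bool.false_eq_true, ite_false, prod_const, card_univ]
  rw [card_edgeSet_top_fin]

/-- **`TV² ≤ χ²` (Cauchy–Schwarz).** For `0 < p < 1` and any `p'`:
`(Σ_z |w_{p'}(z) − w_p(z)|)² ≤ (Σ_z w_p(z)) · Σ_z (w_{p'}(z) − w_p(z))²/w_p(z) = Σ_z w_{p'}(z)²/w_p(z) − 1
= (p'²/p + (1−p')²/(1−p))^{C(n,2)} − 1` (`Σ_z w_r(z) = 1` for every real `r`). [folklore] -/
theorem tv_sq_le_chiSq {n : ℕ} {p : ℝ} (hp0 : 0 < p) (hp1 : p < 1) (p' : ℝ) :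
    (∑ z : Edges n → Bool, |gnpWeight n p' z - gnpWeight n p z|) ^ 2 ≤
      (p' ^ 2 / p + (1 - p') ^ 2 / (1 - p)) ^ (n.choose 2) - 1 := by
  have hw : ∀ z : Edges n → Bool, 0 < gnpWeight n p z := fun z =>
    mul_pos (pow_pos hp0 _) (pow_pos (sub_pos.2 hp1) _)
  have hcs := sum_sq_le_sum_mul_sum_of_sq_le_mul (univ : Finset (Edges n → Bool))
    (r := fun z => |gnpWeight n p' z - gnpWeight n p z|) (f := fun z => gnpWeight n p z)
    (g := fun z => (gnpWeight n p' z - gnpWeight n p z) ^ 2 / gnpWeight n p z)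
    (fun z _ => (hw z).le) (fun z _ => div_nonneg (sq_nonneg _) (hw z).le)
    (fun z _ => le_of_eq (by
      rw [sq_abs, ← mul_div_assoc, mul_div_cancel_left₀ _ (hw z).ne']))
  have hexp : ∀ z : Edges n → Bool, (gnpWeight n p' z - gnpWeight n p z) ^ 2 / gnpWeight n p z =
      gnpWeight n p' z ^ 2 / gnpWeight n p z - 2 * gnpWeight n p' z + gnpWeight n p z := by
    intro z
    have hz := (hw z).ne'
    field_simp
    ring
  rw [sum_gnpWeight, one_mul, sum_congr rfl fun z _ => hexp z, sum_add_distrib, sum_sub_distrib,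
    ← mul_sum, sum_gnpWeight, sum_gnpWeight, sum_gnpWeight_sq_div] at hcs
  linarith

/-- **The χ² base for a sprinkle.** With `p' = p ⊕ ρ = p + ρ − pρ` one has `p' − p = ρ(1−p)` and
`p'²/p + (1−p')²/(1−p) = 1 + ρ²(1−p)/p` (`p ≠ 0`, `1 − p ≠ 0`). [folklore] -/
theorem chiSq_base_sprinkle {p : ℝ} (ρ : ℝ) (hp0 : p ≠ 0) (hp1 : 1 - p ≠ 0) :
    (p + ρ - p * ρ) ^ 2 / p + (1 - (p + ρ - p * ρ)) ^ 2 / (1 - p) = 1 + ρ ^ 2 * (1 - p) / p := by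
  field_simp
  ring

/-- `(1 + a)^N − 1 ≤ exp(Na) − 1 ≤ 2Na` for `0 ≤ a` and `Na ≤ 1` (`1 + a ≤ e^a`,
`|e^x − 1| ≤ 2|x|` on `|x| ≤ 1`). [folklore] -/
theorem one_add_pow_sub_one_le_two_mul {a : ℝ} {N : ℕ} (ha : 0 ≤ a) (h : (N : ℝ) * a ≤ 1) :
    (1 + a) ^ N - 1 ≤ 2 * ((N : ℝ) * a) := by
  have h1 : (1 + a) ^ N ≤ Real.exp ((N : ℝ) * a) := by
    rw [Real.exp_nat_mul]
    exact pow_le_pow_left₀ (by linarith) (by linarith [Real.add_one_le_exp a]) N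
  have h0 : 0 ≤ (N : ℝ) * a := by positivity
  have h2 := Real.abs_exp_sub_one_le (x := (N : ℝ) * a) (by rwa [abs_of_nonneg h0])
  rw [abs_of_nonneg h0] at h2
  linarith [le_abs_self (Real.exp ((N : ℝ) * a) - 1)]

/-! ### The sprinkle at the critical density -/

/-- **Stub G — a CLT-invisible sprinkle.** For `k ≥ 3` and `σ > 1 + 1/(k−1)`:
`TV(G(n, p_c ⊕ n^{-σ}), G(n, p_c)) = Σ_z |w_{p⊕ρ}(z) − w_p(z)| → 0`, `p = p_c = n^{-2/(k-1)}`,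
`ρ = n^{-σ}`, `p ⊕ ρ = p + ρ − pρ`. Proof: `TV² ≤ χ² = (1 + ρ²(1−p)/p)^{C(n,2)} − 1`
(`tv_sq_le_chiSq`, `chiSq_base_sprinkle`) `≤ 2 C(n,2) ρ²(1−p)/p ≤ n^{2 − 2σ + 2/(k−1)} → 0`
(`one_add_pow_sub_one_le_two_mul`), the exponent being negative iff `σ > 1 + 1/(k−1)`, i.e. iff the
expected number `≈ n^{2−σ}/2` of sprinkled edges is `≪ √(C(n,2) p) ≈ n^{1−1/(k−1)}`, the standard
deviation of the edge count of `G(n,p)`. [folklore; cf. Janson–Łuczak–Ruciński, Random Graphs (2000),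
§1.6 (asymptotic equivalence of `G(n,p)` and `G(n,p')`)] -/
theorem stub_gnpTVSprinkle :
    ∀ k : ℕ, 3 ≤ k → ∀ σ : ℝ, 1 + 1 / ((k : ℝ) - 1) < σ →
      Tendsto (fun n : ℕ => ∑ z : Edges n → Bool,
        |gnpWeight n (pc n k + (n : ℝ) ^ (-σ) - pc n k * (n : ℝ) ^ (-σ)) z - gnpWeight n (pc n k) z|)
        atTop (𝓝 0) := by
  intro k hk σ hσ
  have hK : (3 : ℝ) ≤ k := by exact_mod_cast hk
  have hK1 : 0 < (k : ℝ) - 1 := by linarith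
  -- `p = n^{-β}` with `β = 2/(k-1)`; the gain exponent `γ = 2σ - 2 - β > 0`
  set β : ℝ := 2 / ((k : ℝ) - 1) with hβ
  have hβ0 : 0 < β := div_pos two_pos hK1
  set γ : ℝ := 2 * σ - 2 - β with hγ
  have hγ0 : 0 < γ := by
    have h1 : 1 / ((k : ℝ) - 1) = β / 2 := by rw [hβ]; ring
    rw [h1] at hσ
    rw [hγ]
    linarith
  -- the pointwise bound `TV² ≤ n^{-γ}` for `n ≥ 2`
  have hbound : ∀ n : ℕ, 2 ≤ n →
      (∑ z : Edges n → Bool, |gnpWeight n (pc n k + (n : ℝ) ^ (-σ) - pc n k * (n : ℝ) ^ (-σ)) z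
          - gnpWeight n (pc n k) z|) ^ 2 ≤ (n : ℝ) ^ (-γ) := by
    intro n hn
    have hn0 : (0 : ℝ) < n := by exact_mod_cast (by omega : 0 < n)
    have hn1 : (1 : ℝ) < n := by exact_mod_cast (by omega : 1 < n)
    set p : ℝ := pc n k with hp
    set ρ : ℝ := (n : ℝ) ^ (-σ) with hρ
    have hpβ : p = (n : ℝ) ^ (-β) := by rw [hp, pc, hβ, neg_div]
    have hp0 : 0 < p := by rw [hpβ]; exact Real.rpow_pos_of_pos hn0 _
    have hp1 : p < 1 := by
      rw [hpβ]; exact Real.rpow_lt_one_of_one_lt_of_neg hn1 (by linarith)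
    have hρ0 : 0 ≤ ρ := Real.rpow_nonneg hn0.le _
    -- χ² bound
    have h1 := tv_sq_le_chiSq (n := n) hp0 hp1 (p + ρ - p * ρ)
    rw [chiSq_base_sprinkle ρ hp0.ne' (by linarith)] at h1
    set a : ℝ := ρ ^ 2 * (1 - p) / p with ha
    have ha0 : 0 ≤ a := div_nonneg (mul_nonneg (sq_nonneg _) (by linarith)) hp0.le
    -- `C(n,2) · a ≤ n^{-γ}/2`
    have hρ2 : ρ ^ 2 = (n : ℝ) ^ (-(2 * σ)) := by
      rw [hρ, ← Real.rpow_two, ← Real.rpow_mul hn0.le]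
      congr 1
      ring
    have hpinv : p⁻¹ = (n : ℝ) ^ β := by rw [hpβ, Real.rpow_neg hn0.le, inv_inv]
    have key : (n : ℝ) ^ 2 / 2 * (ρ ^ 2 / p) = (n : ℝ) ^ (-γ) / 2 := by
      rw [div_eq_mul_inv (ρ ^ 2) p, hρ2, hpinv, ← Real.rpow_two, ← Real.rpow_add hn0,
        div_mul_eq_mul_div, ← Real.rpow_add hn0,
        show (2 : ℝ) + (-(2 * σ) + β) = -γ by rw [hγ]; ring]
    have hN : (n.choose 2 : ℝ) ≤ (n : ℝ) ^ 2 / 2 := by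
      rw [Nat.cast_choose_two]
      nlinarith
    have haρ : a ≤ ρ ^ 2 / p := by
      rw [ha]
      refine div_le_div_of_nonneg_right ?_ hp0.le
      nlinarith [sq_nonneg ρ]
    have hNa : (n.choose 2 : ℝ) * a ≤ (n : ℝ) ^ (-γ) / 2 :=
      calc (n.choose 2 : ℝ) * a ≤ (n : ℝ) ^ 2 / 2 * (ρ ^ 2 / p) :=
            mul_le_mul hN haρ ha0 (by positivity)
        _ = (n : ℝ) ^ (-γ) / 2 := key
    have hγle : (n : ℝ) ^ (-γ) ≤ 1 := Real.rpow_le_one_of_one_le_of_nonpos hn1.le (by linarith)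
    have h2 := one_add_pow_sub_one_le_two_mul ha0 (by linarith : (n.choose 2 : ℝ) * a ≤ 1)
    linarith
  -- squeeze: `0 ≤ TV ≤ √(n^{-γ}) → 0`
  have hlim : Tendsto (fun n : ℕ => Real.sqrt ((n : ℝ) ^ (-γ))) atTop (𝓝 0) := by
    have h := ((tendsto_rpow_neg_atTop hγ0).comp tendsto_natCast_atTop_atTop).sqrt
    rw [Real.sqrt_zero] at h
    exact h
  refine squeeze_zero' (Eventually.of_forall fun n => sum_nonneg fun z _ => abs_nonneg _)
    ((eventually_ge_atTop 2).mono fun n hn => ?_) hlim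
  exact (le_abs_self _).trans (Real.abs_le_sqrt (hbound n hn))

end Summit.PneNP.PneNP.Theorems.SingleThreshold

end
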